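import Literature.MathematicalPhysics.QuantumFieldTheory.Balaban1983to89.InfiniteVolumeSufficientXII
import HarnessLib

/-!
# Row 47 `equipartition_seam`, stub T — a RUNG for the half-split slack T♭ in the sibling setting:
# T♭'s inequality HOLDS for the untwisted Wilson theory at strong coupling (tree facts only, 0 sorry)

Companion of `Cruxes/IRcof/Lines/equipartition_seam_VacuumSlackHalf.lean` (T♭ ⟹ T).  HONEST: this is the WRONG regime
for row 47 (strong coupling, trivial twist, Wilson weight instead of the split weight `w` at `β → ∞`); it witnesses only
that T♭'s SHAPE — `Z(S) · Z(S+1) ≤ C · Z(2S+1)` on the spatial cube `(2S+1)³`, ONE constant for ALL `S`, three honest torus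
partition functions, no eigenvalue — is a correct and provable kind of statement where the free energy is controlled, and
it ties stub T to the tree's cold-trace instrument (`traceExcess`, `ColdTraceBound`, module XI ∕ XII of the Bałaban
literature formalisation).  The YM mass gap (Clay) is NOT proved; `IRcof` ∕ `IR` 0 ∕ 1.

`wilson_halfSplitSlack_of_strongCoupling`: for a compact metrisable `G`, a continuous unitary `ρ`, `0 ≤ β ≤ r_ρ`
(`strongCouplingRadius ρ`) and EVERY `S' = S + 2 ≥ 2`,
`Z_β((2S'+1)³ × S') · Z_β((2S'+1)³ × (S'+1)) ≤ (1 + A)² · Z_β((2S'+1)⁴)`, `A = 9437184·e·e^{9437184·e}` the volume-free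
cold-trace constant of `coldTraceBound_of_strongCoupling` (time = last index of `wilsonFinTorusPartition`).
Proof: `Z(m) = λ₊^m (1 + X(m))` with `0 ≤ X(S'), X(S'+1) ≤ A` on the cold range (`ColdTraceBound`) and `λ₊^{2S'+1} ≤ Z(2S'+1)`
(`pow_transferSpectralRadius_le_cyclicPartition`).
-/

open MeasureTheory Filter Topology

namespace Summit.QuantumFields.YangMills.Cruxes.IRcof.EquipartitionSeam.VacuumSlackHalf

open Literature.MathematicalPhysics.QuantumFieldTheory
open Literature.MathematicalPhysics.QuantumFieldTheory.Balaban1983to89.Missing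

/-- The volume-free cold-trace constant `A = 9437184·e·e^{9437184·e}` of `coldTraceBound_of_strongCoupling`. -/
noncomputable def rungConst : ℝ := 9437184 * Real.exp 1 * Real.exp (9437184 * Real.exp 1)

theorem rungConst_nonneg : 0 ≤ rungConst := by unfold rungConst; positivity

variable {G : Type} [Group G] [TopologicalSpace G] [IsTopologicalGroup G] [CompactSpace G] [MeasurableSpace G]
  [BorelSpace G] [SecondCountableTopology G] {n : ℕ} (ρ : G →* Matrix (Fin n) (Fin n) ℂ)

/-- **T♭'s shape holds for the Wilson theory at strong coupling**, uniformly in the half-side `S' = S + 2`: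
`Z((2S'+1)³ × S') · Z((2S'+1)³ × (S'+1)) ≤ (1 + A)² · Z((2S'+1)³ × (2S'+1))` for `0 ≤ β ≤ strongCouplingRadius ρ`. -/
theorem wilson_halfSplitSlack_of_strongCoupling (hρ : Continuous ρ)
    (hρu : ∀ g, ρ g ∈ Matrix.unitaryGroup (Fin n) ℂ) {β : ℝ} (hβ0 : 0 ≤ β) (hβ : β ≤ strongCouplingRadius ρ)
    (S : ℕ) :
    wilsonFinTorusPartition ρ β (2 * (S + 2) + 1) (2 * (S + 2) + 1) (2 * (S + 2) + 1) (S + 2) *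
        wilsonFinTorusPartition ρ β (2 * (S + 2) + 1) (2 * (S + 2) + 1) (2 * (S + 2) + 1) (S + 3) ≤
      (1 + rungConst) ^ 2 *
        wilsonFinTorusPartition ρ β (2 * (S + 2) + 1) (2 * (S + 2) + 1) (2 * (S + 2) + 1) (2 * (S + 2) + 1) := by
  have hCT := coldTraceBound_of_strongCoupling ρ hρ hρu hβ0 hβ (S + 2)
  have hl := transferSpectralRadius_pos_of_unitary ρ hρ hρu hβ0 (2 * (S + 2) + 1)
  have hA0 : 0 ≤ rungConst := rungConst_nonneg
  have hexp : ∀ k : ℕ, rungConst * Real.exp (-(1 / 8 * (k : ℝ))) ≤ rungConst := fun k =>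
    mul_le_of_le_one_right hA0 (Real.exp_le_one_iff.2 (by
      have : (0 : ℝ) ≤ 1 / 8 * (k : ℝ) := by positivity
      linarith))
  -- the two cold traces `X(S+2), X(S+3) ≤ A`
  have hx1 : traceExcess ρ β (2 * (S + 2) + 1) (S + 2) ≤ rungConst :=
    (hCT S (by omega)).trans (hexp _)
  have hx2 : traceExcess ρ β (2 * (S + 2) + 1) (S + 1 + 2) ≤ rungConst :=
    (hCT (S + 1) (by omega)).trans (hexp _)
  unfold traceExcess at hx1 hx2
  rw [← wilsonFinTorusPartition_eq_cyclicPartition hρ hρu] at hx1 hx2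
  have hZ1 : wilsonFinTorusPartition ρ β (2 * (S + 2) + 1) (2 * (S + 2) + 1) (2 * (S + 2) + 1) (S + 2) ≤
      (1 + rungConst) * transferSpectralRadius ρ β (2 * (S + 2) + 1) ^ (S + 2) := by
    have h : wilsonFinTorusPartition ρ β (2 * (S + 2) + 1) (2 * (S + 2) + 1) (2 * (S + 2) + 1) (S + 2) /
        transferSpectralRadius ρ β (2 * (S + 2) + 1) ^ (S + 2) ≤ 1 + rungConst := by linarith
    rwa [div_le_iff₀ (pow_pos hl _)] at h
  have hZ2 : wilsonFinTorusPartition ρ β (2 * (S + 2) + 1) (2 * (S + 2) + 1) (2 * (S + 2) + 1) (S + 3) ≤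
      (1 + rungConst) * transferSpectralRadius ρ β (2 * (S + 2) + 1) ^ (S + 3) := by
    have h : wilsonFinTorusPartition ρ β (2 * (S + 2) + 1) (2 * (S + 2) + 1) (2 * (S + 2) + 1) (S + 1 + 2) /
        transferSpectralRadius ρ β (2 * (S + 2) + 1) ^ (S + 1 + 2) ≤ 1 + rungConst := by linarith
    rw [div_le_iff₀ (pow_pos hl _)] at h
    exact h
  -- `λ₊^{2S'+1} ≤ Z(2S'+1)`
  have hZ3 : transferSpectralRadius ρ β (2 * (S + 2) + 1) ^ (2 * (S + 2) + 1) ≤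
      wilsonFinTorusPartition ρ β (2 * (S + 2) + 1) (2 * (S + 2) + 1) (2 * (S + 2) + 1) (2 * (S + 2) + 1) := by
    have h := pow_transferSpectralRadius_le_cyclicPartition ρ hρ hρu hβ0 (2 * (S + 2) + 1) (2 * S + 3)
    rw [← wilsonFinTorusPartition_eq_cyclicPartition hρ hρu] at h
    exact h
  have hW1 : 0 ≤ wilsonFinTorusPartition ρ β (2 * (S + 2) + 1) (2 * (S + 2) + 1) (2 * (S + 2) + 1) (S + 2) :=
    (wilsonFinTorusPartition_pos hρ β _ _ _ _).le
  have hC : 0 ≤ 1 + rungConst := by positivity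
  calc wilsonFinTorusPartition ρ β (2 * (S + 2) + 1) (2 * (S + 2) + 1) (2 * (S + 2) + 1) (S + 2) *
        wilsonFinTorusPartition ρ β (2 * (S + 2) + 1) (2 * (S + 2) + 1) (2 * (S + 2) + 1) (S + 3)
      ≤ ((1 + rungConst) * transferSpectralRadius ρ β (2 * (S + 2) + 1) ^ (S + 2)) *
          ((1 + rungConst) * transferSpectralRadius ρ β (2 * (S + 2) + 1) ^ (S + 3)) :=
        mul_le_mul hZ1 hZ2 ((wilsonFinTorusPartition_pos hρ β _ _ _ _).le) (mul_nonneg hC (pow_nonneg hl.le _))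
    _ = (1 + rungConst) ^ 2 * transferSpectralRadius ρ β (2 * (S + 2) + 1) ^ (2 * (S + 2) + 1) := by ring
    _ ≤ (1 + rungConst) ^ 2 *
          wilsonFinTorusPartition ρ β (2 * (S + 2) + 1) (2 * (S + 2) + 1) (2 * (S + 2) + 1) (2 * (S + 2) + 1) :=
        mul_le_mul_of_nonneg_left hZ3 (by positivity)

end Summit.QuantumFields.YangMills.Cruxes.IRcof.EquipartitionSeam.VacuumSlackHalf
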